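import Summits.PneNP.PneNP.Theorems.ChebyshevTracialDesignCrossingFormsNull
import HarnessLib

/-!
# Cell pnp-psdrank, route `ChebyshevTracialDesign`: CG_1 REDUCES TO PAIR-SYMMETRIC TEST VECTORS — for every mask `f` (`|f| ≤ 1`) and all
# matching-dependent test vectors `v_M` (`|v_M| ≤ 1`), replacing `v_M` by its symmetrisation `v^s_M(p) = ½(v_M(p) + v_M(π_M p))` changes
# `Σ_M Σ_U W(U,M) f(U) (v_M·x_U)²` by at most `(n³ + n⁴/4)·(Σ|w_c|)·√P_{D−4}` (crux `TracialDecayExp20`, stmt-PneNP-19878)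

Brick 100 (prover g18; MEMO-21 §3(c')). Brick 99 (`…CrossingFormsNull`) showed that the pair-ANTISYMMETRIC (null) block of the localised moment
matrix `F_M[f] = Σ_U W(U,M) f(U) x_Ux_Uᵀ` is negligible for every mask. Here the CROSS TERMS are added: with `v = v^s + v^a`
(`v^s = ½(v + v∘π_M)`, `v^a = ½(v − v∘π_M)`), `(v·x)² = (v^s·x)² + 2(v^s·x)(v^a·x) + (v^a·x)²`, and the mixed term carries ONE crossing factor
`x_p − x_{π_M p}`, so it is again a sum of `n³` scalar crossing-pin cells (brick 99 §1 `crossingCell_scalar_abs_le`, brick 24b):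
* §1 **`crossTerm_abs_le`** — `|Σ_M Σ_U W f (u_M·x_U)(v_M·x_U)| ≤ (n³/2)·(Σ|w_c|)·√P_{D−4}` for `|u_M| ≤ 1` arbitrary and `v_M` pair-antisymmetric
  with `|v_M| ≤ 1`;
* §2 **`value_sq_sub_symm_abs_le`** — THE REDUCTION: `|Σ_M Σ_U W f (v_M·x_U)² − Σ_M Σ_U W f (v^s_M·x_U)²| ≤ (n³ + n⁴/4)·(Σ|w_c|)·√P_{D−4}` for
  every `|f| ≤ 1`, `|v_M| ≤ 1`.
CONSEQUENCE (MEMO-21 §3(c'), by name): the conditional-Grigoriev statement CG_1 — «`Σ_M sup_{|v_M|≤1} (Σ_U W f (v_M·x_U)²)₊ ≤ e^{−aD}`-small» — is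
EQUIVALENT up to `e^{−(D/4−O(1))·ln(n/D)}` to the same statement over PAIR-SYMMETRIC test vectors only, i.e. to a psd-order statement about the
PAIR-PINNED design-value matrix `A^f_M(e,e') = Σ_U W(U,M) f(U)·1[e ∪ e' ⊆ U]` (`e,e' ∈ M`) modulo further crossing cells: the r-free first
rung above NTF is a statement about ONE [0,1]-function and the pairs of edges of a random matching.
[cite: Rothvoss2017, §2 and Lemma 7 (PDF pp. 6–8)] [cite: Grigoriev2001, Lemma 1.4 (PDF p. 8)] [cite: GriblingDelaatLaurent2019, §5]
Stature: support/instrument (kernel lane, no defs, axioms standard). WHAT THIS IS NOT: nothing on the pair-symmetric block itself, no proof or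
refutation of `TracialDecayExp20`, nothing on psd rank of P_PM(K_n), no P-vs-NP content. Supports stmt-PneNP-19878.
-/

set_option linter.dupNamespace false -- `Summit.PneNP.PneNP.…`: summit = sub-problem (D-0017)

noncomputable section

namespace Summit.PneNP.PneNP.Theorems.ChebyshevTracialDesignSymmetricReduction

open Finset Matrix Literature.Barriers.PneNP Literature.Combinatorics.Optimization
open Literature.Combinatorics.SimpleGraph.CycleSpace
open Summit.PneNP.PneNP.Theorems.ChebyshevTracialDesignCrossingFormsNull

variable {n : ℕ}

/-! ### §1 The cross term -/

/-- **THE CROSS TERM IS NEGLIGIBLE.** For an exact design `(n, t = 2c'+1, T, D, B_v, C, w)` with `4 ≤ D ≤ 2c'`, a mask `|f| ≤ 1`, arbitrary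
matching-dependent `u_M` with `|u_M(p)| ≤ 1`, and pair-antisymmetric `v_M` with `|v_M(p)| ≤ 1`:
`|Σ_M Σ_U W(U,M) f(U) (u_M·x_U)(v_M·x_U)| ≤ (n³/2)·(Σ_c|w_c|)·√P_{D−4}`.
[cite: Rothvoss2017, §2 and Lemma 7 (PDF pp. 6–8)] [cite: Grigoriev2001, Lemma 1.4 (PDF p. 8)] -/
theorem crossTerm_abs_le {c' T D : ℕ} {Bv : ℝ} {C : Finset ℕ} {w : ℕ → ℝ} (hn : Even n)
    (hdes : IsExactDesign n (2 * c' + 1) T D Bv C w) (hD : D ≤ 2 * c') (hD4 : 4 ≤ D)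
    (f : OddSet n → ℝ) (hf : ∀ U, |f U| ≤ 1)
    (u : PMatch n → Fin n → ℝ) (hu1 : ∀ M p, |u M p| ≤ 1)
    (v : PMatch n → Fin n → ℝ) (hanti : ∀ M p, v M (M.2.partner p) = -v M p) (hv1 : ∀ M p, |v M p| ≤ 1) :
    |∑ M : PMatch n, ∑ U : OddSet n, levelWeight n (2 * c' + 1) C w U M *
        (f U * ((∑ p, u M p * (if p ∈ U.1 then (1 : ℝ) else 0)) * (∑ p, v M p * (if p ∈ U.1 then (1 : ℝ) else 0))))| ≤
      (n : ℝ) ^ 3 / 2 * ((∑ c ∈ C, |w c|) * Real.sqrt (∏ i ∈ range ((D - 4) / 2 + 1), ((2 * i + 1 : ℝ) / ((n : ℝ) - 2 * i)))) := by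
  classical
  set β : ℝ := (∑ c ∈ C, |w c|) * Real.sqrt (∏ i ∈ range ((D - 4) / 2 + 1), ((2 * i + 1 : ℝ) / ((n : ℝ) - 2 * i))) with hβ
  set x : OddSet n → Fin n → ℝ := fun U p => if p ∈ U.1 then (1 : ℝ) else 0 with hx
  set d : Fin n → Fin n → OddSet n → ℝ := fun p p' U => x U p - x U p' with hd
  have hx1 : ∀ U q, |x U q| ≤ 1 := fun U q => by rw [hx]; dsimp only; split_ifs <;> norm_num
  have hd1 : ∀ p p' U, |d p p' U| ≤ 1 := fun p p' U => by
    rw [hd, hx]; dsimp only; split_ifs <;> norm_num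
  have hdcross : ∀ p p' (U : OddSet n), ¬ Crosses U.1 s(p, p') → d p p' U = 0 := by
    intro p p' U hU
    rw [crosses_mk] at hU
    rw [hd, hx]; dsimp only
    by_cases hp : p ∈ U.1 <;> by_cases hp' : p' ∈ U.1 <;> simp [hp, hp'] <;> tauto
  -- `(u·x)(v·x) = ½ Σ_{(q,p)} u_q v_p x_q d_{p,πp}`, then re-index `p' = πp`
  set Tm : (Fin n × Fin n) × Fin n → OddSet n → PMatch n → ℝ := fun c U M =>
    levelWeight n (2 * c' + 1) C w U M *
      ((f U * (x U c.1.1 * d c.1.2 c.2 U)) * (if M.2.partner c.1.2 = c.2 then u M c.1.1 * v M c.1.2 else 0)) with hTm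
  have hinner : ∀ (M : PMatch n) (U : OddSet n), levelWeight n (2 * c' + 1) C w U M *
      (f U * ((∑ p, u M p * x U p) * (∑ p, v M p * x U p))) = (1 / 2) * ∑ c : (Fin n × Fin n) × Fin n, Tm c U M := by
    intro M U
    rw [sum_mul_indicator_eq_half_sum_diff M (v M) (hanti M) (x U)]
    have hre : ∀ p : Fin n, v M p * (x U p - x U (M.2.partner p)) =
        ∑ p' : Fin n, (if M.2.partner p = p' then v M p else 0) * d p p' U := by
      intro p
      rw [Fintype.sum_eq_single (M.2.partner p)]
      · rw [if_pos rfl, hd]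
      · intro p' hp'; rw [if_neg (fun h => hp' h.symm), zero_mul]
    simp_rw [hre]
    rw [mul_left_comm (∑ a, u M a * x U a) (1 / 2 : ℝ), Finset.sum_mul_sum]
    rw [Fintype.sum_prod_type (f := fun c : (Fin n × Fin n) × Fin n => Tm c U M),
      Fintype.sum_prod_type (f := fun a : Fin n × Fin n => ∑ p' : Fin n, Tm (a, p') U M), hTm]
    simp only [Finset.mul_sum]
    refine sum_congr rfl fun a _ => sum_congr rfl fun b _ => sum_congr rfl fun c _ => ?_
    by_cases h : M.2.partner b = c
    · rw [if_pos h, if_pos h]; ring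
    · rw [if_neg h, if_neg h]; ring
  have hexp : ∑ M : PMatch n, ∑ U : OddSet n, levelWeight n (2 * c' + 1) C w U M *
      (f U * ((∑ p, u M p * x U p) * (∑ p, v M p * x U p))) =
      (1 / 2) * ∑ c : (Fin n × Fin n) × Fin n, ∑ U : OddSet n, ∑ M : PMatch n, Tm c U M := by
    simp_rw [hinner]
    simp only [← Finset.mul_sum]
    congr 1
    calc ∑ M : PMatch n, ∑ U : OddSet n, ∑ c : (Fin n × Fin n) × Fin n, Tm c U M
        = ∑ M : PMatch n, ∑ c : (Fin n × Fin n) × Fin n, ∑ U : OddSet n, Tm c U M := sum_congr rfl fun M _ => sum_comm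
      _ = ∑ c : (Fin n × Fin n) × Fin n, ∑ M : PMatch n, ∑ U : OddSet n, Tm c U M := sum_comm
      _ = ∑ c : (Fin n × Fin n) × Fin n, ∑ U : OddSet n, ∑ M : PMatch n, Tm c U M := sum_congr rfl fun c _ => sum_comm
  have hcell : ∀ c : (Fin n × Fin n) × Fin n, |∑ U : OddSet n, ∑ M : PMatch n, Tm c U M| ≤ β := by
    intro c
    rw [hTm]
    refine crossingCell_scalar_abs_le hn hdes hD hD4 c.1.2 c.2 (fun U => f U * (x U c.1.1 * d c.1.2 c.2 U)) (fun U hU => ?_)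
      (fun U => ?_) (fun M => if M.2.partner c.1.2 = c.2 then u M c.1.1 * v M c.1.2 else 0) (fun M hM => ?_) (fun M => ?_)
    · rw [hdcross _ _ U hU, mul_zero, mul_zero]
    · rw [abs_mul, abs_mul]
      have h1 := hf U; have h2 := hx1 U c.1.1; have h3 := hd1 c.1.2 c.2 U
      nlinarith [abs_nonneg (f U), abs_nonneg (x U c.1.1), abs_nonneg (d c.1.2 c.2 U),
        mul_nonneg (abs_nonneg (x U c.1.1)) (abs_nonneg (d c.1.2 c.2 U))]
    · rw [if_neg]
      intro hp
      exact hM (hp ▸ M.2.mk_partner_mem c.1.2)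
    · split_ifs
      · rw [abs_mul]; have := hu1 M c.1.1; have := hv1 M c.1.2; nlinarith [abs_nonneg (u M c.1.1), abs_nonneg (v M c.1.2)]
      · rw [abs_zero]; exact zero_le_one
  rw [hexp, abs_mul, abs_of_pos (by norm_num : (0 : ℝ) < 1 / 2)]
  have h3 : |∑ c : (Fin n × Fin n) × Fin n, ∑ U : OddSet n, ∑ M : PMatch n, Tm c U M| ≤ (n : ℝ) ^ 3 * β := by
    calc _ ≤ ∑ c : (Fin n × Fin n) × Fin n, β := (abs_sum_le_sum_abs _ _).trans (sum_le_sum fun c _ => hcell c)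
      _ = (n : ℝ) ^ 3 * β := by
          rw [sum_const, card_univ, Fintype.card_prod, Fintype.card_prod, Fintype.card_fin, nsmul_eq_mul]; push_cast; ring
  calc 1 / 2 * |∑ c : (Fin n × Fin n) × Fin n, ∑ U : OddSet n, ∑ M : PMatch n, Tm c U M| ≤ 1 / 2 * ((n : ℝ) ^ 3 * β) :=
        mul_le_mul_of_nonneg_left h3 (by norm_num)
    _ = (n : ℝ) ^ 3 / 2 * β := by ring

/-! ### §2 The reduction to pair-symmetric test vectors -/

/-- **CG_1 REDUCES TO PAIR-SYMMETRIC TEST VECTORS.** For an exact design `(n, t = 2c'+1, T, D, B_v, C, w)` with `4 ≤ D ≤ 2c'`, a mask `|f| ≤ 1`,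
and ANY matching-dependent test vectors `v_M` with `|v_M(p)| ≤ 1`, with `v^s_M(p) := ½(v_M(p) + v_M(π_M p))`:
`|Σ_M Σ_U W f (v_M·x_U)² − Σ_M Σ_U W f (v^s_M·x_U)²| ≤ (n³ + n⁴/4)·(Σ_c|w_c|)·√P_{D−4}`.
[cite: Rothvoss2017, §2 and Lemma 7 (PDF pp. 6–8)] [cite: Grigoriev2001, Lemma 1.4 (PDF p. 8)] [cite: GriblingDelaatLaurent2019, §5] -/
theorem value_sq_sub_symm_abs_le {c' T D : ℕ} {Bv : ℝ} {C : Finset ℕ} {w : ℕ → ℝ} (hn : Even n)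
    (hdes : IsExactDesign n (2 * c' + 1) T D Bv C w) (hD : D ≤ 2 * c') (hD4 : 4 ≤ D)
    (f : OddSet n → ℝ) (hf : ∀ U, |f U| ≤ 1) (v : PMatch n → Fin n → ℝ) (hv1 : ∀ M p, |v M p| ≤ 1) :
    |∑ M : PMatch n, ∑ U : OddSet n, levelWeight n (2 * c' + 1) C w U M *
          (f U * (∑ p, v M p * (if p ∈ U.1 then (1 : ℝ) else 0)) ^ 2) -
        ∑ M : PMatch n, ∑ U : OddSet n, levelWeight n (2 * c' + 1) C w U M *
          (f U * (∑ p, (1 / 2) * (v M p + v M (M.2.partner p)) * (if p ∈ U.1 then (1 : ℝ) else 0)) ^ 2)| ≤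
      ((n : ℝ) ^ 3 + (n : ℝ) ^ 4 / 4) *
        ((∑ c ∈ C, |w c|) * Real.sqrt (∏ i ∈ range ((D - 4) / 2 + 1), ((2 * i + 1 : ℝ) / ((n : ℝ) - 2 * i)))) := by
  set β : ℝ := (∑ c ∈ C, |w c|) * Real.sqrt (∏ i ∈ range ((D - 4) / 2 + 1), ((2 * i + 1 : ℝ) / ((n : ℝ) - 2 * i))) with hβ
  set vs : PMatch n → Fin n → ℝ := fun M p => (1 / 2) * (v M p + v M (M.2.partner p)) with hvs
  set va : PMatch n → Fin n → ℝ := fun M p => (1 / 2) * (v M p - v M (M.2.partner p)) with hva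
  have hvs1 : ∀ M p, |vs M p| ≤ 1 := fun M p => by
    rw [hvs]; dsimp only
    have h1 := abs_le.1 (hv1 M p); have h2 := abs_le.1 (hv1 M (M.2.partner p))
    rw [abs_le]; constructor <;> linarith
  have hva1 : ∀ M p, |va M p| ≤ 1 := fun M p => by
    rw [hva]; dsimp only
    have h1 := abs_le.1 (hv1 M p); have h2 := abs_le.1 (hv1 M (M.2.partner p))
    rw [abs_le]; constructor <;> linarith
  have hanti : ∀ M p, va M (M.2.partner p) = -va M p := fun M p => by
    rw [hva]; dsimp only; rw [M.2.partner_partner]; ring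
  -- `(v·x)² − (v^s·x)² = 2(v^s·x)(v^a·x) + (v^a·x)²`
  have hsplit : ∀ (M : PMatch n) (U : OddSet n),
      f U * (∑ p, v M p * (if p ∈ U.1 then (1 : ℝ) else 0)) ^ 2 -
        f U * (∑ p, (1 / 2) * (v M p + v M (M.2.partner p)) * (if p ∈ U.1 then (1 : ℝ) else 0)) ^ 2 =
      2 * (f U * ((∑ p, vs M p * (if p ∈ U.1 then (1 : ℝ) else 0)) * (∑ p, va M p * (if p ∈ U.1 then (1 : ℝ) else 0)))) +
        f U * (∑ p, va M p * (if p ∈ U.1 then (1 : ℝ) else 0)) ^ 2 := by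
    intro M U
    have hv : ∑ p, v M p * (if p ∈ U.1 then (1 : ℝ) else 0) =
        ∑ p, vs M p * (if p ∈ U.1 then (1 : ℝ) else 0) + ∑ p, va M p * (if p ∈ U.1 then (1 : ℝ) else 0) := by
      rw [← sum_add_distrib]
      exact sum_congr rfl fun p _ => by rw [hvs, hva]; ring
    rw [hv]; ring
  have hdiff : ∑ M : PMatch n, ∑ U : OddSet n, levelWeight n (2 * c' + 1) C w U M *
          (f U * (∑ p, v M p * (if p ∈ U.1 then (1 : ℝ) else 0)) ^ 2) -
        ∑ M : PMatch n, ∑ U : OddSet n, levelWeight n (2 * c' + 1) C w U M *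
          (f U * (∑ p, (1 / 2) * (v M p + v M (M.2.partner p)) * (if p ∈ U.1 then (1 : ℝ) else 0)) ^ 2) =
      2 * ∑ M : PMatch n, ∑ U : OddSet n, levelWeight n (2 * c' + 1) C w U M *
          (f U * ((∑ p, vs M p * (if p ∈ U.1 then (1 : ℝ) else 0)) * (∑ p, va M p * (if p ∈ U.1 then (1 : ℝ) else 0)))) +
        ∑ M : PMatch n, ∑ U : OddSet n, levelWeight n (2 * c' + 1) C w U M *
          (f U * (∑ p, va M p * (if p ∈ U.1 then (1 : ℝ) else 0)) ^ 2) := by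
    rw [← sum_sub_distrib, mul_sum, ← sum_add_distrib]
    refine sum_congr rfl fun M _ => ?_
    rw [← sum_sub_distrib, mul_sum, ← sum_add_distrib]
    refine sum_congr rfl fun U _ => ?_
    rw [← mul_sub, hsplit]; ring
  rw [hdiff]
  have h1 := crossTerm_abs_le hn hdes hD hD4 f hf vs hvs1 va hanti hva1
  have h2 := crossingForms_value_abs_le hn hdes hD hD4 f hf va hanti hva1
  have hβ0 : 0 ≤ β := mul_nonneg (sum_nonneg fun c _ => abs_nonneg _) (Real.sqrt_nonneg _)
  calc _ ≤ |2 * ∑ M : PMatch n, ∑ U : OddSet n, levelWeight n (2 * c' + 1) C w U M *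
            (f U * ((∑ p, vs M p * (if p ∈ U.1 then (1 : ℝ) else 0)) * (∑ p, va M p * (if p ∈ U.1 then (1 : ℝ) else 0))))| +
          |∑ M : PMatch n, ∑ U : OddSet n, levelWeight n (2 * c' + 1) C w U M *
            (f U * (∑ p, va M p * (if p ∈ U.1 then (1 : ℝ) else 0)) ^ 2)| := abs_add_le _ _
    _ ≤ 2 * ((n : ℝ) ^ 3 / 2 * β) + (n : ℝ) ^ 4 / 4 * β := by
        rw [abs_mul, abs_of_pos (by norm_num : (0 : ℝ) < 2)]
        exact add_le_add (mul_le_mul_of_nonneg_left h1 (by norm_num)) h2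
    _ = ((n : ℝ) ^ 3 + (n : ℝ) ^ 4 / 4) * β := by ring

end Summit.PneNP.PneNP.Theorems.ChebyshevTracialDesignSymmetricReduction

end
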